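import Summits.AtomisticToContinuum.Crystallization.Theorems.ChargedEnergyGapKinkCertAA
import HarnessLib

/-!
# ChargedEnergyGap · (Σ₃) KinkCert part A — mountain law, kernel table certificates, key-in-the-middle clause (lens-3 NODE 85) — part 2 of 2 (sequel of `…ChargedEnergyGapKinkCertAA`)

Split for the 400-line cap by the landing lane (hand-2 g40); the module docstring of part 1 (`…ChargedEnergyGapKinkCertAA`) describes the whole node.  Same namespace; all FQNs unchanged.
0 sorry; standard axioms.
-/

noncomputable section
open scoped Classical
open Literature.MathematicalPhysics.StatisticalMechanics Literature.Geometry.DiscreteGeometry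
open Summit.AtomisticToContinuum.Crystallization.Theses.PricedLinkCensus
open Summit.AtomisticToContinuum.Crystallization.Theorems.ChargedEnergyGapNegative

namespace Summit.AtomisticToContinuum.Crystallization.Theorems.ChargedEnergyGapChartDial

/-! ## §A3 The key-in-the-middle clause for key columns 4, 5, 6 -/

section MiddleHigh

/-- ★★ **ONE KEY COLUMN**: given the pair-depth certificate `(j, E, T)`, the chain certificate `(κ, T, 93.5, q₀, cuts)`, `κ > 0`,
`κ(2q₀ − 1) ≥ 320` and `E ≤ E(j, 3)`, two outer holes of columns `≤ j` around a key with `κ ≤ k₂` obeying the window law and the cap carry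
`≤ E(j, 3)`: either the table says so, or the pair is deep (`e₁² + e₃² ≥ T`) and the chain excludes every key depth. -/
theorem kc_middle_case (j : ℕ) {E T κ q₀ : ℚ} {cuts : List ℚ} (hcert : kcPairCert j E T = true)
    (hchain : kcChainCert κ T (187 / 2) q₀ cuts = true) (hκ0 : 0 < κ) (hq₀ : 320 ≤ κ * (2 * q₀ - 1))
    (hE : ((E : ℚ) : ℝ) ≤ lineExcess j 3)
    {ρ k₂ e₁ m₁ k₁ e₂ e₃ m₃ k₃ : ℝ} (hρ1 : ρ ≤ 1) (hκ : (κ : ℝ) ≤ k₂)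
    (hr₁ : 1 ≤ capKRow m₁) (hr₃ : 1 ≤ capKRow m₃) (hc₁ : capKCol k₁ ≤ j) (hc₃ : capKCol k₃ ≤ j)
    (hme₁ : m₁ ≤ e₁) (hme₃ : m₃ ≤ e₃) (hlo₂ : 187 / 2 ≤ e₂)
    (hW : k₂ * (2 * e₂ - ρ) ≤ 160 + Real.sqrt (e₂ ^ 2 - e₁ ^ 2) + Real.sqrt (e₂ ^ 2 - e₃ ^ 2))
    (hcap : k₂ * (2 * e₂ - ρ) ≤ 320) :
    capK m₁ k₁ + capK m₃ k₃ ≤ lineExcess j 3 := by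
  have h74₁ := kb_capKRow_le m₁
  have h74₃ := kb_capKRow_le m₃
  rcases kc_pair_read hcert hr₁ h74₁ hr₃ h74₃ with hsum | hT
  · have h1 := kc_capK_le_rowMax m₁ k₁ hc₁
    have h3 := kc_capK_le_rowMax m₃ k₃ hc₃
    have hs : ((kcRowMax j (capKRow m₁) : ℚ) : ℝ) + ((kcRowMax j (capKRow m₃) : ℚ) : ℝ) ≤ ((E : ℚ) : ℝ) := by
      exact_mod_cast hsum
    linarith
  · exfalso
    have hlo₁ := fc_le_of_capKRow m₁ hr₁
    have hlo₃ := fc_le_of_capKRow m₃ hr₃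
    have q1 := kc_rowLo_le m₁ hr₁
    have q3 := kc_rowLo_le m₃ hr₃
    have p1 : (0 : ℝ) ≤ ((kcRowLo (capKRow m₁) : ℚ) : ℝ) := by exact_mod_cast kc_rowLo_nonneg _
    have p3 : (0 : ℝ) ≤ ((kcRowLo (capKRow m₃) : ℚ) : ℝ) := by exact_mod_cast kc_rowLo_nonneg _
    have hTq : ((T : ℚ) : ℝ) ≤ ((kcRowLo (capKRow m₁) : ℚ) : ℝ) * ((kcRowLo (capKRow m₁) : ℚ) : ℝ) +
        ((kcRowLo (capKRow m₃) : ℚ) : ℝ) * ((kcRowLo (capKRow m₃) : ℚ) : ℝ) := by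
      exact_mod_cast hT
    have s1 := mul_le_mul q1 q1 p1 (by linarith)
    have s3 := mul_le_mul q3 q3 p3 (by linarith)
    have hT' : ((T : ℚ) : ℝ) ≤ e₁ ^ 2 + e₃ ^ 2 := by nlinarith
    have hκ0' : (0 : ℝ) < κ := by exact_mod_cast hκ0
    have he₂q : e₂ ≤ ((q₀ : ℚ) : ℝ) := by
      rcases le_or_gt e₂ ((q₀ : ℚ) : ℝ) with h | hlt
      · exact h
      · exfalso
        have hq' : (320 : ℝ) ≤ κ * (2 * q₀ - 1) := by exact_mod_cast hq₀
        have a1 : (κ : ℝ) * (2 * q₀ - 1) < κ * (2 * e₂ - ρ) := mul_lt_mul_of_pos_left (by linarith) hκ0'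
        have a2 : (κ : ℝ) * (2 * e₂ - ρ) ≤ k₂ * (2 * e₂ - ρ) := mul_le_mul_of_nonneg_right hκ (by linarith)
        linarith
    have hlo : (((187 / 2 : ℚ)) : ℝ) = 187 / 2 := by push_cast; ring
    exact kc_chain_sound cuts q₀ hchain hρ1 hκ hκ0'.le (by rw [hlo]; norm_num) (by rw [hlo]; linarith)
      (by rw [hlo]; linarith) (by rw [hlo]; linarith) he₂q hT' hW

/-- ★★★ **THE KEY-IN-THE-MIDDLE CLAUSE FOR KEY COLUMNS `4, 5, 6` (PROVED)**: in the three-hole system (hole data, two legs, four parabolas,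
window; `0 < ρ ≤ 1`, gaps `n₁, n₂ ≥ 1`), if the middle hole carries the largest kink and its kink column is `4, 5` or `6`, the two outer holes
carry at most `E(j, 3)`. -/
theorem kc_middle_high {ρ : ℝ} (hρ : 0 < ρ) (hρ1 : ρ ≤ 1) {n₁ n₂ : ℕ}
    {e₁ m₁ a₁ b₁ k₁ e₂ m₂ a₂ b₂ k₂ e₃ m₃ a₃ b₃ k₃ : ℝ} (hn₁ : 1 ≤ n₁) (hn₂ : 1 ≤ n₂)
    (hw : ρ * ((n₁ : ℝ) + n₂) ≤ 160 + 2 * ρ)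
    (H₁ : IsHoleData ρ e₁ m₁ a₁ b₁ k₁) (H₂ : IsHoleData ρ e₂ m₂ a₂ b₂ k₂) (H₃ : IsHoleData ρ e₃ m₃ a₃ b₃ k₃)
    (hL₁ : a₁ * (2 * e₁ - a₁) + b₂ * (2 * e₂ - b₂) ≤ 2 * ρ ^ 2 * ((n₁ : ℝ) - 1))
    (hL₂ : a₂ * (2 * e₂ - a₂) + b₃ * (2 * e₃ - b₃) ≤ 2 * ρ ^ 2 * ((n₂ : ℝ) - 1))
    (hF₁ : e₂ ^ 2 ≤ e₁ ^ 2 - (n₁ : ℝ) * (a₁ * (2 * e₁ - a₁)) + ρ ^ 2 * n₁ * ((n₁ : ℝ) - 1))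
    (hB₁ : e₁ ^ 2 ≤ e₂ ^ 2 - (n₁ : ℝ) * (b₂ * (2 * e₂ - b₂)) + ρ ^ 2 * n₁ * ((n₁ : ℝ) - 1))
    (hF₂ : e₃ ^ 2 ≤ e₂ ^ 2 - (n₂ : ℝ) * (a₂ * (2 * e₂ - a₂)) + ρ ^ 2 * n₂ * ((n₂ : ℝ) - 1))
    (hB₂ : e₂ ^ 2 ≤ e₃ ^ 2 - (n₂ : ℝ) * (b₃ * (2 * e₃ - b₃)) + ρ ^ 2 * n₂ * ((n₂ : ℝ) - 1))
    (hk₁ : k₁ ≤ k₂) (hk₃ : k₃ ≤ k₂) (hj4 : 4 ≤ capKCol k₂) (hj6 : capKCol k₂ ≤ 6) :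
    capK m₁ k₁ + capK m₃ k₃ ≤ lineExcess (capKCol k₂) 3 := by
  obtain ⟨ha₁0, -, -, -, -, -, hma₁, -, hr₁, -, -⟩ := H₁
  obtain ⟨ha₂0, ha₂, hb₂0, hb₂, hk₂e, hρm₂, hma₂, -, hr₂, -, -⟩ := H₂
  obtain ⟨-, -, hb₃0, -, -, -, -, hmb₃, hr₃, -, -⟩ := H₃
  have hlo₁ := fc_le_of_capKRow m₁ hr₁
  have hlo₂ := fc_le_of_capKRow m₂ hr₂
  have hlo₃ := fc_le_of_capKRow m₃ hr₃
  have hA₁ : 0 ≤ a₁ * (2 * e₁ - a₁) := mul_nonneg ha₁0 (by linarith)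
  have hB₃ : 0 ≤ b₃ * (2 * e₃ - b₃) := mul_nonneg hb₃0 (by linarith)
  have hn₁R : (1 : ℝ) ≤ n₁ := by exact_mod_cast hn₁
  have hn₂R : (1 : ℝ) ≤ n₂ := by exact_mod_cast hn₂
  have hW := kc_window_law hρ hn₁R hn₂R hw ha₂0 ha₂ hb₂0 hb₂ hk₂e hA₁ hB₃ hF₁ hB₁ hF₂ hB₂
  have hcap := kc_key_cap hρ hw ha₂0 ha₂ hb₂0 hb₂ hk₂e hA₁ hB₃ hL₁ hL₂
  have hc₁j : capKCol k₁ ≤ capKCol k₂ := kb_capKCol_mono hk₁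
  have hc₃j : capKCol k₃ ≤ capKCol k₂ := kb_capKCol_mono hk₃
  obtain ⟨j, hj⟩ : ∃ j : ℕ, capKCol k₂ = j := ⟨_, rfl⟩
  have hκj : 1 + ((j : ℝ) - 2) / 10 ≤ k₂ := kb_le_of_capKCol k₂ j (by omega) (by omega) (by omega)
  rw [hj] at hc₁j hc₃j hj4 hj6 ⊢
  have hme₁ : m₁ ≤ e₁ := by linarith
  have hme₃ : m₃ ≤ e₃ := by linarith
  have he₂ : 187 / 2 ≤ e₂ := by linarith
  interval_cases j
  · have hE := kc_lineExcess_three 4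
    rw [kc_lineE1_4] at hE
    exact kc_middle_case 4 kcPair4_true kcChain4_true (by norm_num) (by norm_num) hE hρ1
      (by push_cast at hκj ⊢; linarith) hr₁ hr₃ hc₁j hc₃j hme₁ hme₃ he₂ hW hcap
  · have hE := kc_lineExcess_three 5
    rw [kc_lineE1_5] at hE
    exact kc_middle_case 5 kcPair5_true kcChain5_true (by norm_num) (by norm_num) hE hρ1
      (by push_cast at hκj ⊢; linarith) hr₁ hr₃ hc₁j hc₃j hme₁ hme₃ he₂ hW hcap
  · have hE := kc_lineExcess_three 6
    rw [kc_lineE1_6] at hE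
    exact kc_middle_case 6 kcPair6_true kcChain6_true (by norm_num) (by norm_num) hE hρ1
      (by push_cast at hκj ⊢; linarith) hr₁ hr₃ hc₁j hc₃j hme₁ hme₃ he₂ hW hcap

end MiddleHigh

end Summit.AtomisticToContinuum.Crystallization.Theorems.ChargedEnergyGapChartDial
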